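import Summits.AnomalousDissipation.AnomalousDissipation.Theorems.SolenoidalFractalHomogenisationRealisedQuasiStaticCellLawUpperSomeSlotLadders
import Summits.AnomalousDissipation.AnomalousDissipation.Theorems.SolenoidalFractalHomogenisationRealisedQuasiStaticCellLawUpperSomeLadderCone
import HarnessLib

/-!
# K2R `RealisedQuasiStaticCellLaw`, line `floquet-bloch`, stub `stub_upperSome`: per-slot LOWER law and cone bounds of the
# two polarisation blocks of the cell problem (Galerkin truncation, full slot, weak coupling)

Summits-side helper file (everything proved; no definitions, no named facts; `--supports stmt-AnomalousDissipation-20446`).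
* `outOfPlane_slot_cone` — cone of the out-of-plane fast block over a full slot (`fast_energy_window` on the package
  `outOfPlane_slot_ladder`): `Σ_{J≠0}‖u_J(t)‖² ≤ e^{−ΛΔ(t−a)}Σ_{J≠0}‖u_J(a)‖² + (|g₁|√2V/Δ)²` given `‖u₀‖ ≤ V` on the slot;
* `inPlane_slot_lower` — the in-plane twin of `outOfPlane_slot_lower` (`…UpperSomeSlotLaw`): LOWER slot law of
  `‖u₀‖² − βΣ_{J≠0}‖u_J‖²` with the exponent `2Λτ_j(d₀ + (1+ε)σg₁²(1−4ρ/3)) + slack`, its interior form, and the cone of the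
  in-plane fast block (`slavedLadder_trapezoid_ge` + `fast_energy_window` on the package `inPlane_slot_ladder`).
Energy LOWER-bound half of the K2R bracket; not anomalous dissipation.
-/

set_option linter.dupNamespace false -- layout D-0017: `AnomalousDissipation.AnomalousDissipation` repeats by design

noncomputable section

namespace Summit.AnomalousDissipation.AnomalousDissipation.Theorems.SolenoidalFractalHomogenisation.RealisedQuasiStaticCellLaw

open Set MeasureTheory Filter Topology Function Complex Matrix
open scoped InnerProductSpace ComplexConjugate Matrix BigOperators
open Literature.Analysis Literature.Analysis.FunctionSpaces Literature.Analysis.FunctionSpaces.Torus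
open Literature.Analysis.FluidPDE Literature.Analysis.FluidPDE.LatticeShear
open Literature.Analysis.ODE.ThreeTermLadder
open Summit.AnomalousDissipation.AnomalousDissipation.Theorems.SolenoidalFractalHomogenisation.PermissibleCarrier

variable {k₀ : ℕ}

/-! ## §3 The cell problem: cone of the out-of-plane fast block, lower law + cone of the in-plane block -/

/-- **Cone of the out-of-plane fast block over a full slot.** In the setting of `outOfPlane_slot_ladder` with a gap
`d_J ≥ d₀ + Δ` off `0` on the segment `Wset ∋ 0, ±1` and a bound `‖u₀(t)‖ ≤ V` on the slow component along the slot: for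
every `t` in the slot, `Σ_{J≠0}‖u_J(t)‖² ≤ e^{−ΛΔ(t−a)} Σ_{J≠0}‖u_J(a)‖² + (|g₁|√2 V/Δ)²`, `u_J = ⟪ζ, α_N(·)(k_J)⟫`. -/
theorem outOfPlane_slot_cone (W : LatticeWord k₀) {n : ℕ} (hn : 0 < n) {κ : ℝ} (hκ : 0 < κ)
    (ℓ : Fin 3 → ℤ) {w₀ : UnitAddTorus (Fin 3) → EuclideanSpace ℝ (Fin 3)}
    (hw₀ : FunctionSpaces.Torus.MemSobolev 1 (FunctionSpaces.EuclideanSpace.complexify ∘ w₀))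
    (hdiv : FunctionSpaces.Torus.IsWeaklyDivFree w₀) (hmean : FunctionSpaces.Torus.HasZeroMean w₀)
    (hsupp : ∀ k : Fin 3 → ℤ, ¬ ((∃ z : Fin 3 → ℤ, k = ℓ + (n:ℤ) • z) ∨ (∃ z : Fin 3 → ℤ, k = -ℓ + (n:ℤ) • z)) →
      UnitAddTorus.mFourierCoeff (FunctionSpaces.EuclideanSpace.complexify ∘ w₀) k = 0)
    {N : ℕ} (hBN : (Finset.univ.biUnion fun j : Fin k₀ =>
        ({(fun i => (W.phase j).m i * n), -(fun i => (W.phase j).m i * n)} : Finset (Fin 3 → ℤ))) ⊆ freqBall N)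
    {T : ℝ} (p : ℕ) (j : Fin k₀) (hT : (p : ℝ) * W.period + W.start j + (W.phase j).τ ≤ T)
    (k0 : Fin 3 → ℤ) {ζ : EuclideanSpace ℂ (Fin 3)} (hζ₀ : ∑ i, (k0 i : ℂ) * ζ i = 0)
    (hζK : ∑ i, (((fun i => (W.phase j).m i * (n : ℤ)) i : ℤ) : ℂ) * ζ i = 0)
    {Wset : Finset ℤ} (hW : ∀ J : ℤ, J ∈ Wset ↔ k0 + J • (fun i => (W.phase j).m i * (n : ℤ)) ∈ freqBall N)
    (h1 : (1 : ℤ) ∈ Wset) (hm1 : (-1 : ℤ) ∈ Wset)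
    (Λ Δ g₁ V : ℝ) (hΛ : Λ = κ * (4 * Real.pi ^ 2 * freqNormSq (fun i => (W.phase j).m i * (n : ℤ))))
    (hΔ0 : 0 < Δ)
    (hgap : ∀ J ∈ Wset, J ≠ 0 →
      freqNormSq k0 / freqNormSq (fun i => (W.phase j).m i * (n : ℤ)) + Δ ≤
        freqNormSq (k0 + J • (fun i => (W.phase j).m i * (n : ℤ))) / freqNormSq (fun i => (W.phase j).m i * (n : ℤ)))
    (hg₁ : g₁ = 2 * Real.pi * (∑ i, (W.phase j).e i * (k0 i : ℝ)) *
        ‖Complex.exp ((W.phase j).φ * Complex.I) *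
          (1 / (2 * ((2 * Real.pi * ‖latticeVec (W.phase j).m‖ : ℝ) : ℂ) * Complex.I))‖ * (1 / (n : ℝ)) / Λ)
    (hV0 : 0 ≤ V)
    (hV : ∀ t ∈ Icc ((p : ℝ) * W.period + W.start j) ((p : ℝ) * W.period + W.start j + (W.phase j).τ),
      ‖inner ℂ ζ ((pvSetup_cell W hn hκ.le ℓ hw₀ hdiv hmean hsupp).galerkinCoeffAt N t k0)‖ ≤ V) :
    ∀ t ∈ Icc ((p : ℝ) * W.period + W.start j) ((p : ℝ) * W.period + W.start j + (W.phase j).τ),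
      ∑ J ∈ Wset.erase 0, ‖inner ℂ ζ ((pvSetup_cell W hn hκ.le ℓ hw₀ hdiv hmean hsupp).galerkinCoeffAt N t
          (k0 + J • (fun i => (W.phase j).m i * (n : ℤ))))‖ ^ 2 ≤
        Real.exp (-(Λ * Δ) * (t - ((p : ℝ) * W.period + W.start j))) *
            ∑ J ∈ Wset.erase 0, ‖inner ℂ ζ ((pvSetup_cell W hn hκ.le ℓ hw₀ hdiv hmean hsupp).galerkinCoeffAt N
              ((p : ℝ) * W.period + W.start j) (k0 + J • (fun i => (W.phase j).m i * (n : ℤ))))‖ ^ 2 +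
          (|g₁| * Real.sqrt 2 * V / Δ) ^ 2 := by
  classical
  obtain ⟨g, v, hgdef, hvsupp, hderiv, hnorm, hv0⟩ := outOfPlane_slot_ladder W hn hκ ℓ hw₀ hdiv hmean hsupp hBN p j hT
    k0 hζ₀ hζK hW Λ g₁ hΛ hg₁
  set a : ℝ := (p : ℝ) * W.period + W.start j with ha
  set d : ℤ → ℝ := fun J => freqNormSq (k0 + J • (fun i => (W.phase j).m i * (n : ℤ))) /
    freqNormSq (fun i => (W.phase j).m i * (n : ℤ)) with hddef
  have hΛpos : 0 < Λ := by rw [hΛ]; exact cellRate_pos (W.phase j) hn hκ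
  have hs : ∀ J ∈ Wset, |(fun _ : ℤ => (1 : ℝ)) J| ≤ 1 := fun J _ => by simp
  have hγ : Real.sqrt 2 ^ 2 = (fun _ : ℤ => (1 : ℝ)) 0 ^ 2 + (fun _ : ℤ => (1 : ℝ)) (-1) ^ 2 := by
    rw [Real.sq_sqrt (by norm_num)]; norm_num
  have hgapd : ∀ J ∈ Wset, J ≠ 0 → d 0 + Δ ≤ d J := by
    intro J hJ hJ0; simpa [hddef] using hgap J hJ hJ0
  have hd0' : 0 ≤ d 0 := by
    simp only [hddef]; exact div_nonneg (freqNormSq_nonneg _) (freqNormSq_nonneg _)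
  have hgT : ∀ t ∈ Icc a (a + (W.phase j).τ), |g t| ≤ |g₁| := by
    intro t ht; rw [hgdef t ht]; exact abs_mul_trapezoid_le _ _ _ _
  have hV' : ∀ t ∈ Icc a (a + (W.phase j).τ), ‖v t 0‖ ≤ V := by
    intro t ht; rw [hv0 t]; exact hV t ht
  have hmain := fast_energy_window Wset h1 hm1 d (fun _ => (1 : ℝ)) Λ |g₁| Δ (Real.sqrt 2) V a (a + (W.phase j).τ) g v
    hs hγ (Real.sqrt_nonneg _) hΔ0 hgapd hd0' hΛpos hgT hV' hV0 hvsupp hderiv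
  intro t ht
  have h := hmain t ht
  have hE : ∀ τ, ∑ J ∈ Wset.erase 0, ‖v τ J‖ ^ 2 = ∑ J ∈ Wset.erase 0, ‖inner ℂ ζ
      ((pvSetup_cell W hn hκ.le ℓ hw₀ hdiv hmean hsupp).galerkinCoeffAt N τ
        (k0 + J • (fun i => (W.phase j).m i * (n : ℤ))))‖ ^ 2 := by
    intro τ; refine Finset.sum_congr rfl fun J _ => ?_; rw [hnorm τ J]
  rw [hE, hE] at h
  exact h

/-- **Weighted in-plane block energy: LOWER law over a full slot, and cone of the in-plane fast block.** In the setting of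
`inPlane_slot_contraction` (links = Leray cosines `s_J = p_J·p_{J+1}`, `γ² = s₀² + s₋₁²`, `σ = s₋₁²/(d₋₁−d₀) + s₀²/(d₁−d₀)`,
`γ² ≤ βΔεσ`) with the weak-coupling hypothesis of the lower functional (ramp slack included) and a bound `‖u₀(t)‖ ≤ V`
along the slot: with `E = 2Λτ_j(d₀ + (1+ε)σg₁²(1−4ρ/3)) + 40βγ²Λτ_jg₁⁴(1+g₁²σ²)/Δ³ + 48βγ²g₁²/(ρτ_jΛΔ³)`,
(i) `exp(−E)‖u₀(a)‖² − βΣ_{J≠0}‖u_J(a)‖² ≤ ‖u₀(a+τ_j)‖² − βΣ_{J≠0}‖u_J(a+τ_j)‖²`; (ii) the same lower bound for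
`‖u₀(t)‖²` inside the slot; (iii) `Σ_{J≠0}‖u_J(t)‖² ≤ e^{−ΛΔ(t−a)}Σ_{J≠0}‖u_J(a)‖² + (|g₁|γV/Δ)²` inside the slot. -/
theorem inPlane_slot_lower (W : LatticeWord k₀) {n : ℕ} (hn : 0 < n) {κ : ℝ} (hκ : 0 < κ)
    (ℓ : Fin 3 → ℤ) {w₀ : UnitAddTorus (Fin 3) → EuclideanSpace ℝ (Fin 3)}
    (hw₀ : FunctionSpaces.Torus.MemSobolev 1 (FunctionSpaces.EuclideanSpace.complexify ∘ w₀))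
    (hdiv : FunctionSpaces.Torus.IsWeaklyDivFree w₀) (hmean : FunctionSpaces.Torus.HasZeroMean w₀)
    (hsupp : ∀ k : Fin 3 → ℤ, ¬ ((∃ z : Fin 3 → ℤ, k = ℓ + (n:ℤ) • z) ∨ (∃ z : Fin 3 → ℤ, k = -ℓ + (n:ℤ) • z)) →
      UnitAddTorus.mFourierCoeff (FunctionSpaces.EuclideanSpace.complexify ∘ w₀) k = 0)
    {N : ℕ} (hBN : (Finset.univ.biUnion fun j : Fin k₀ =>
        ({(fun i => (W.phase j).m i * n), -(fun i => (W.phase j).m i * n)} : Finset (Fin 3 → ℤ))) ⊆ freqBall N)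
    {T : ℝ} (p : ℕ) (j : Fin k₀) (hT : (p : ℝ) * W.period + W.start j + (W.phase j).τ ≤ T)
    (k0 : Fin 3 → ℤ) (hk : ∀ J : ℤ, k0 + J • (fun i => (W.phase j).m i * (n : ℤ)) ∈ freqBall N →
      k0 + J • (fun i => (W.phase j).m i * (n : ℤ)) ≠ 0)
    {ζr : Fin 3 → ℝ} (hζ1 : ζr ⬝ᵥ ζr = 1) (hζ0 : ζr ⬝ᵥ (fun i => ((k0 i : ℤ) : ℝ)) = 0)
    (hζK : ζr ⬝ᵥ (fun i => (((fun i => (W.phase j).m i * (n : ℤ)) i : ℤ) : ℝ)) = 0)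
    {pf : ℤ → Fin 3 → ℝ}
    (hp : ∀ J : ℤ, pf J = (Real.sqrt ((fun i => (((k0 + J • (fun i => (W.phase j).m i * (n : ℤ))) i : ℤ) : ℝ)) ⬝ᵥ
        (fun i => (((k0 + J • (fun i => (W.phase j).m i * (n : ℤ))) i : ℤ) : ℝ))))⁻¹ •
        (fun i => (((k0 + J • (fun i => (W.phase j).m i * (n : ℤ))) i : ℤ) : ℝ)) ⨯₃ ζr)
    {Wset : Finset ℤ} (hW : ∀ J : ℤ, J ∈ Wset ↔ k0 + J • (fun i => (W.phase j).m i * (n : ℤ)) ∈ freqBall N)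
    (h0 : (0 : ℤ) ∈ Wset) (h1 : (1 : ℤ) ∈ Wset) (hm1 : (-1 : ℤ) ∈ Wset)
    (hs : ∀ J ∈ Wset, |pf J ⬝ᵥ pf (J + 1)| ≤ 1)
    (Λ Δ ε β σ g₁ γ V : ℝ) (hΛ : Λ = κ * (4 * Real.pi ^ 2 * freqNormSq (fun i => (W.phase j).m i * (n : ℤ))))
    (hΔ0 : 0 < Δ) (hε : 0 ≤ ε) (hβ : 0 ≤ β)
    (hgap : ∀ J ∈ Wset, J ≠ 0 →
      freqNormSq k0 / freqNormSq (fun i => (W.phase j).m i * (n : ℤ)) + Δ ≤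
        freqNormSq (k0 + J • (fun i => (W.phase j).m i * (n : ℤ))) / freqNormSq (fun i => (W.phase j).m i * (n : ℤ)))
    (hσ : σ = (pf (-1) ⬝ᵥ pf 0) ^ 2 / (freqNormSq (k0 + (-1 : ℤ) • (fun i => (W.phase j).m i * (n : ℤ))) /
          freqNormSq (fun i => (W.phase j).m i * (n : ℤ)) - freqNormSq k0 / freqNormSq (fun i => (W.phase j).m i * (n : ℤ))) +
        (pf 0 ⬝ᵥ pf 1) ^ 2 / (freqNormSq (k0 + (1 : ℤ) • (fun i => (W.phase j).m i * (n : ℤ))) /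
          freqNormSq (fun i => (W.phase j).m i * (n : ℤ)) - freqNormSq k0 / freqNormSq (fun i => (W.phase j).m i * (n : ℤ))))
    (hγ : γ ^ 2 = (pf 0 ⬝ᵥ pf 1) ^ 2 + (pf (-1) ⬝ᵥ pf 0) ^ 2) (hγ0 : 0 ≤ γ)
    (hg₁ : g₁ = 2 * Real.pi * (∑ i, (W.phase j).e i * (k0 i : ℝ)) *
        ‖Complex.exp ((W.phase j).φ * Complex.I) *
          (1 / (2 * ((2 * Real.pi * ‖latticeVec (W.phase j).m‖ : ℝ) : ℂ) * Complex.I))‖ * (1 / (n : ℝ)) / Λ)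
    (hβγ : γ ^ 2 ≤ β * Δ * ε * σ)
    (hsmall : g₁ ^ 2 * (4 * γ ^ 2 / Δ + 2 * (1 + ε) * σ) +
      2 * (4 * β * γ ^ 2 * (Λ * |g₁| ^ 3 * σ + |g₁| / (W.ramp * (W.phase j).τ) + Λ * |g₁| ^ 2) ^ 2 / (Λ * Δ ^ 3)) / Λ ≤ Δ)
    (hV0 : 0 ≤ V)
    (hV : ∀ t ∈ Icc ((p : ℝ) * W.period + W.start j) ((p : ℝ) * W.period + W.start j + (W.phase j).τ),
      ‖inner ℂ (WithLp.toLp 2 (Complex.ofReal ∘ pf 0) : EuclideanSpace ℂ (Fin 3))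
        ((pvSetup_cell W hn hκ.le ℓ hw₀ hdiv hmean hsupp).galerkinCoeffAt N t k0)‖ ≤ V) :
    (Real.exp (-(2 * Λ * (W.phase j).τ * (freqNormSq k0 / freqNormSq (fun i => (W.phase j).m i * (n : ℤ)) +
            (1 + ε) * σ * (g₁ ^ 2 * (1 - 4 * W.ramp / 3))) +
          40 * β * γ ^ 2 * Λ * (W.phase j).τ * g₁ ^ 4 * (1 + g₁ ^ 2 * σ ^ 2) / Δ ^ 3 +
          48 * β * γ ^ 2 * g₁ ^ 2 / (W.ramp * (W.phase j).τ * Λ * Δ ^ 3))) *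
        ‖inner ℂ (WithLp.toLp 2 (Complex.ofReal ∘ pf 0) : EuclideanSpace ℂ (Fin 3))
            ((pvSetup_cell W hn hκ.le ℓ hw₀ hdiv hmean hsupp).galerkinCoeffAt N ((p : ℝ) * W.period + W.start j) k0)‖ ^ 2 -
        β * ∑ J ∈ Wset.erase 0, ‖inner ℂ (WithLp.toLp 2 (Complex.ofReal ∘ pf J) : EuclideanSpace ℂ (Fin 3))
            ((pvSetup_cell W hn hκ.le ℓ hw₀ hdiv hmean hsupp).galerkinCoeffAt N ((p : ℝ) * W.period + W.start j)
              (k0 + J • (fun i => (W.phase j).m i * (n : ℤ))))‖ ^ 2 ≤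
      ‖inner ℂ (WithLp.toLp 2 (Complex.ofReal ∘ pf 0) : EuclideanSpace ℂ (Fin 3))
          ((pvSetup_cell W hn hκ.le ℓ hw₀ hdiv hmean hsupp).galerkinCoeffAt N
            ((p : ℝ) * W.period + W.start j + (W.phase j).τ) k0)‖ ^ 2 -
        β * ∑ J ∈ Wset.erase 0, ‖inner ℂ (WithLp.toLp 2 (Complex.ofReal ∘ pf J) : EuclideanSpace ℂ (Fin 3))
          ((pvSetup_cell W hn hκ.le ℓ hw₀ hdiv hmean hsupp).galerkinCoeffAt N
            ((p : ℝ) * W.period + W.start j + (W.phase j).τ) (k0 + J • (fun i => (W.phase j).m i * (n : ℤ))))‖ ^ 2) ∧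
    (∀ t ∈ Icc ((p : ℝ) * W.period + W.start j) ((p : ℝ) * W.period + W.start j + (W.phase j).τ),
      Real.exp (-(2 * Λ * (W.phase j).τ * (freqNormSq k0 / freqNormSq (fun i => (W.phase j).m i * (n : ℤ)) +
            (1 + ε) * σ * (g₁ ^ 2 * (1 - 4 * W.ramp / 3))) +
          40 * β * γ ^ 2 * Λ * (W.phase j).τ * g₁ ^ 4 * (1 + g₁ ^ 2 * σ ^ 2) / Δ ^ 3 +
          48 * β * γ ^ 2 * g₁ ^ 2 / (W.ramp * (W.phase j).τ * Λ * Δ ^ 3))) *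
        ‖inner ℂ (WithLp.toLp 2 (Complex.ofReal ∘ pf 0) : EuclideanSpace ℂ (Fin 3))
            ((pvSetup_cell W hn hκ.le ℓ hw₀ hdiv hmean hsupp).galerkinCoeffAt N ((p : ℝ) * W.period + W.start j) k0)‖ ^ 2 -
        β * ∑ J ∈ Wset.erase 0, ‖inner ℂ (WithLp.toLp 2 (Complex.ofReal ∘ pf J) : EuclideanSpace ℂ (Fin 3))
            ((pvSetup_cell W hn hκ.le ℓ hw₀ hdiv hmean hsupp).galerkinCoeffAt N ((p : ℝ) * W.period + W.start j)
              (k0 + J • (fun i => (W.phase j).m i * (n : ℤ))))‖ ^ 2 ≤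
      ‖inner ℂ (WithLp.toLp 2 (Complex.ofReal ∘ pf 0) : EuclideanSpace ℂ (Fin 3))
          ((pvSetup_cell W hn hκ.le ℓ hw₀ hdiv hmean hsupp).galerkinCoeffAt N t k0)‖ ^ 2) ∧
    (∀ t ∈ Icc ((p : ℝ) * W.period + W.start j) ((p : ℝ) * W.period + W.start j + (W.phase j).τ),
      ∑ J ∈ Wset.erase 0, ‖inner ℂ (WithLp.toLp 2 (Complex.ofReal ∘ pf J) : EuclideanSpace ℂ (Fin 3))
          ((pvSetup_cell W hn hκ.le ℓ hw₀ hdiv hmean hsupp).galerkinCoeffAt N t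
            (k0 + J • (fun i => (W.phase j).m i * (n : ℤ))))‖ ^ 2 ≤
        Real.exp (-(Λ * Δ) * (t - ((p : ℝ) * W.period + W.start j))) *
            ∑ J ∈ Wset.erase 0, ‖inner ℂ (WithLp.toLp 2 (Complex.ofReal ∘ pf J) : EuclideanSpace ℂ (Fin 3))
              ((pvSetup_cell W hn hκ.le ℓ hw₀ hdiv hmean hsupp).galerkinCoeffAt N ((p : ℝ) * W.period + W.start j)
                (k0 + J • (fun i => (W.phase j).m i * (n : ℤ))))‖ ^ 2 +
          (|g₁| * γ * V / Δ) ^ 2) := by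
  classical
  obtain ⟨g, v, hgdef, hvsupp, hderiv, hnorm, hv0⟩ := inPlane_slot_ladder W hn hκ ℓ hw₀ hdiv hmean hsupp hBN p j hT
    k0 hk hζ1 hζ0 hζK hp hW Λ g₁ hΛ hg₁
  set a : ℝ := (p : ℝ) * W.period + W.start j with ha
  set τ : ℝ := (W.phase j).τ with hτdef
  have hτ : 0 < τ := (W.phase j).τ_pos
  set d : ℤ → ℝ := fun J => freqNormSq (k0 + J • (fun i => (W.phase j).m i * (n : ℤ))) /
    freqNormSq (fun i => (W.phase j).m i * (n : ℤ)) with hddef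
  set s : ℤ → ℝ := fun J => pf J ⬝ᵥ pf (J + 1) with hsdef
  have hΛpos : 0 < Λ := by rw [hΛ]; exact cellRate_pos (W.phase j) hn hκ
  have hs' : ∀ J ∈ Wset, |s J| ≤ 1 := fun J hJ => hs J hJ
  have hγ' : γ ^ 2 = s 0 ^ 2 + s (-1) ^ 2 := by rw [hγ]; simp only [hsdef, zero_add, neg_add_cancel]
  have hσ' : σ = s (-1) ^ 2 / (d (-1) - d 0) + s 0 ^ 2 / (d 1 - d 0) := by
    rw [hσ]; simp only [hddef, hsdef, zero_smul, add_zero, neg_add_cancel, zero_add]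
  have hgapd : ∀ J ∈ Wset, J ≠ 0 → d 0 + Δ ≤ d J := by
    intro J hJ hJ0; simpa [hddef] using hgap J hJ hJ0
  have hd0' : 0 ≤ d 0 := by
    simp only [hddef]; exact div_nonneg (freqNormSq_nonneg _) (freqNormSq_nonneg _)
  have hgT : ∀ t ∈ Icc a (a + τ), |g t| ≤ |g₁| := by
    intro t ht; rw [hgdef t ht]; exact abs_mul_trapezoid_le _ _ _ _
  have hV' : ∀ t ∈ Icc a (a + τ), ‖v t 0‖ ≤ V := by
    intro t ht; rw [hv0 t]; exact hV t ht
  have hsmall' : g₁ ^ 2 * (4 * γ ^ 2 / Δ + 2 * (1 + ε) * σ) +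
      2 * (4 * β * γ ^ 2 * (Λ * |g₁| ^ 3 * σ + |g₁| / (W.ramp * τ) + Λ * |g₁| ^ 2) ^ 2 / (Λ * Δ ^ 3)) / Λ ≤ Δ := hsmall
  have hlow := slavedLadder_trapezoid_ge Wset h0 h1 hm1 d s Λ Δ γ σ ε β g₁ τ W.ramp a g v hs' hγ' hγ0 hσ' hΔ0 hgapd
    hd0' hΛpos hε hβ hβγ hτ W.ramp_pos W.ramp_le hgdef hsmall' hvsupp hderiv
  have hcone := fast_energy_window Wset h1 hm1 d s Λ |g₁| Δ γ V a (a + τ) g v hs' hγ' hγ0 hΔ0 hgapd hd0' hΛpos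
    hgT hV' hV0 hvsupp hderiv
  -- remove the gauge
  have hE0 : ∀ t, ‖v t 0‖ ^ 2 = ‖inner ℂ (WithLp.toLp 2 (Complex.ofReal ∘ pf 0) : EuclideanSpace ℂ (Fin 3))
      ((pvSetup_cell W hn hκ.le ℓ hw₀ hdiv hmean hsupp).galerkinCoeffAt N t k0)‖ ^ 2 := by
    intro t; rw [hv0 t]
  have hE : ∀ t, ∑ J ∈ Wset.erase 0, ‖v t J‖ ^ 2 = ∑ J ∈ Wset.erase 0,
      ‖inner ℂ (WithLp.toLp 2 (Complex.ofReal ∘ pf J) : EuclideanSpace ℂ (Fin 3))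
        ((pvSetup_cell W hn hκ.le ℓ hw₀ hdiv hmean hsupp).galerkinCoeffAt N t
          (k0 + J • (fun i => (W.phase j).m i * (n : ℤ))))‖ ^ 2 := by
    intro t; refine Finset.sum_congr rfl fun J _ => ?_; rw [hnorm t J]
  simp only [hE0, hE] at hlow hcone
  have hd0 : d 0 = freqNormSq k0 / freqNormSq (fun i => (W.phase j).m i * (n : ℤ)) := by simp [hddef]
  rw [hd0] at hlow
  refine ⟨?_, fun t ht => ?_, fun t ht => hcone t ht⟩
  · convert hlow.1 using 3
  · convert hlow.2 t ht using 3

end Summit.AnomalousDissipation.AnomalousDissipation.Theorems.SolenoidalFractalHomogenisation.RealisedQuasiStaticCellLaw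

end
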